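import Summits.CriticalPhenomena.PercolationContinuityZ3.Theorems.PercNearOneGluingNoHeavyLowerTailSahiTangentCylinderPairsTwoWeights
import Summits.CriticalPhenomena.PercolationContinuityZ3.Theorems.PercNearOneGluingNoHeavyLowerTailSahiQuantC3Principal

/-!
# `NoHeavyLowerTail` (crux stmt-CriticalPhenomena-4575), Sahi programme: the all-orders contraction inequality for **ORTHANT PAIRS ON GRIDS** —
# principal up-sets `cyl t_l ⊇ cyl b_l` of a product of finite chains `[K+1]^d` under ANY product probability weight, every order `n`

Support file (Sahi cell, seat `prim-sahi-p1`, generation 50; `--supports stmt-CriticalPhenomena-4575`).  Pure proofs, NO definitions, no `sorry`,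
standard axioms.  Vocabulary of `…SahiQuantC3Principal` (gen 48): `cyl a = {x : a ≤ x}` (principal up-set / orthant of the grid `Fin d → Fin (K+1)`),
`tail g t = Σ_{u ≥ t} g u`, `mass_cyl` (the mass of an orthant under a product weight is the product of the tails).

THE RESULT (`sahiE_coin_orthantPairs_grid_ge`).  Grid `X = Fin d → Fin (K+1)`, product probability weight `π(ω) = Π_a g_a(ω_a)` (`g_a ≥ 0`,
`Σ_u g_a(u) = 1`), points `t_l ≤ b_l` (so `cyl t_l ⊇ cyl b_l`), coin `s ∈ [0,1]`, slots `F_l(ε,ω) = ε ? 1_{cyl t_l}(ω) : 1_{cyl b_l}(ω)`: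
`s · E_n^{π}(1_{cyl t_0},…,1_{cyl t_{n−1}}) ≤ E_n^{B_s⊗π}(F_0,…,F_{n−1})` — Conjecture T_n for ORTHANT (principal) pairs on every grid with every product
measure, at every order (`d = 1`: chains, cf. gen 47's Theorem A for all FKG weights; `K = 1`: the cube theorem `sahiE_coin_cylinders_ge`).
PROOF = TRANSPORT.  The BINARY ENCODING of a chain: `ω_a ≥ j` (`1 ≤ j ≤ K`) ⟺ bits `β_{a,0} = … = β_{a,j−1} = 1` with INDEPENDENT bits of biases
`q_{a,i} = tail(i+1)/tail(i)`; then `cyl x` becomes the CYLINDER `C(σ(x))`, `σ(x) = {(a,i) : i < x_a} ⊆ Fin d × Fin K`, with `σ(x ⊔ y) = σ(x) ∪ σ(y)` and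
`π(cyl x) = Π_a tail_a(x_a) = M(σ(x))` (telescoping).  Hence the grid family and the cylinder-pair family on the cube have the same mixed moments,
and `sahiE_congr_of_moments` transports `sahiE_coin_cylinders_ge`.
Nothing conjectural is asserted. [this work]
-/

namespace Summit.CriticalPhenomena.PercolationContinuityZ3.Theorems.SahiTangentCyl

open Finset Function Literature.Combinatorics.Sahi2008
open Literature.Probability.LatticeModels (mass)
open Literature.Probability.Percolation.DecisionTree (ind ind_of_mem ind_of_not_mem)
open Summit.CriticalPhenomena.PercolationContinuityZ3.Theorems.SahiQuantC3 (cyl mem_cyl cyl_inter tail tail_nonneg tail_antitone mass_cyl)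
open scoped BigOperators

noncomputable section

variable {d K : ℕ}

/-! ### Orthants of the grid -/

/-- `cyl ⊥` is everything. [folklore] -/
theorem cyl_bot : cyl (⊥ : Fin d → Fin (K + 1)) = univ := by
  ext ω; simp [mem_cyl]

/-- `1_univ = 1`. [folklore] -/
theorem setInd_univ' {β : Type*} [Fintype β] [DecidableEq β] : setInd (univ : Finset β) = 1 := by
  funext x; simp [setInd_apply]

/-- Products of orthant indicators: `Π_{l∈S} 1_{cyl t_l} = 1_{cyl (⊔_S t_l)}`. [this work] -/
theorem prod_setInd_cyl {n : ℕ} (t : Fin n → Fin d → Fin (K + 1)) (S : Finset (Fin n)) :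
    ∏ l ∈ S, setInd (cyl (t l)) = setInd (cyl (S.sup t)) := by
  induction S using Finset.induction_on with
  | empty => rw [Finset.prod_empty, Finset.sup_empty, cyl_bot, setInd_univ']
  | insert a s ha ih => rw [Finset.prod_insert ha, ih, setInd_mul, cyl_inter, Finset.sup_insert]

/-- Products of orthant PAIR slots on `Bool × grid`. [this work] -/
theorem prod_pairSlot_cyl {n : ℕ} (t b : Fin n → Fin d → Fin (K + 1)) (S : Finset (Fin n)) :
    ∏ l ∈ S, (fun z : Bool × (Fin d → Fin (K + 1)) => if z.1 then setInd (cyl (t l)) z.2 else setInd (cyl (b l)) z.2)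
      = fun z => if z.1 then setInd (cyl (S.sup t)) z.2 else setInd (cyl (S.sup b)) z.2 := by
  induction S using Finset.induction_on with
  | empty =>
    funext z; rcases z with ⟨e, ω⟩
    cases e <;> simp [cyl_bot, setInd_univ']
  | insert a s ha ih =>
    rw [Finset.prod_insert ha, ih]
    funext z; rcases z with ⟨e, ω⟩
    cases e
    · simp only [Pi.mul_apply, Bool.false_eq_true, if_false]
      rw [Finset.sup_insert, ← cyl_inter]; exact congrFun (setInd_mul _ _) ω
    · simp only [Pi.mul_apply, if_true]
      rw [Finset.sup_insert, ← cyl_inter]; exact congrFun (setInd_mul _ _) ω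

/-- The two-layer expectation splits over the layers (generic base type). [folklore] -/
theorem ex_coin_gen {β : Type*} [Fintype β] (w : β → ℝ) (s : ℝ) (G : Bool × β → ℝ) :
    ex (fun z : Bool × β => if z.1 then s * w z.2 else (1 - s) * w z.2) G
      = s * ex w (fun x => G (true, x)) + (1 - s) * ex w (fun x => G (false, x)) := by
  simp only [ex, Fintype.sum_prod_type, Fintype.sum_bool, if_true, if_false, Bool.false_eq_true, Finset.mul_sum, mul_assoc]

/-! ### The binary encoding of the grid into the cube `Fin d × Fin K` -/

/-- The tail at level `0` is the total mass. [this work] -/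
theorem tail_mk_zero (g : Fin (K + 1) → ℝ) : tail g ⟨0, Nat.succ_pos K⟩ = ∑ u, g u := by
  unfold tail
  congr 1
  ext u
  simp only [Finset.mem_filter, Finset.mem_univ, true_and, iff_true]
  exact Fin.mk_le_of_le_val (Nat.zero_le _)

/-- The bit biases `q_{a,i} = tail(i+1)/tail(i)` (`0` if `tail(i) = 0`) lie in `[0,1]`. [this work] -/
theorem bitBias_mem (g : Fin d → Fin (K + 1) → ℝ) (hg0 : ∀ a u, 0 ≤ g a u) (p : Fin d × Fin K) :
    (if tail (g p.1) p.2.castSucc = 0 then (0 : ℝ) else tail (g p.1) p.2.succ / tail (g p.1) p.2.castSucc) ∈ unitInterval := by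
  split_ifs with h
  · exact ⟨le_rfl, zero_le_one⟩
  · refine ⟨div_nonneg (tail_nonneg (hg0 p.1) _) (tail_nonneg (hg0 p.1) _), div_le_one_of_le₀ ?_ (tail_nonneg (hg0 p.1) _)⟩
    exact tail_antitone (hg0 p.1) (Fin.castSucc_le_succ p.2)

/-- **Telescoping**: `Π_{i < m} q_{a,i} = tail_a(m)` (`m ≤ K`). [this work] -/
theorem prod_bitBias_eq_tail (g : Fin d → Fin (K + 1) → ℝ) (hg0 : ∀ a u, 0 ≤ g a u) (hg1 : ∀ a, ∑ u, g a u = 1) (a : Fin d) :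
    ∀ (m : ℕ) (hm : m ≤ K),
      ∏ i ∈ (univ : Finset (Fin K)).filter (fun i : Fin K => i.val < m),
          (if tail (g a) i.castSucc = 0 then (0 : ℝ) else tail (g a) i.succ / tail (g a) i.castSucc)
        = tail (g a) ⟨m, Nat.lt_succ_of_le hm⟩ := by
  intro m
  induction m with
  | zero =>
    intro _
    have h0 : (univ : Finset (Fin K)).filter (fun i : Fin K => i.val < 0) = ∅ := by ext i; simp
    rw [h0, Finset.prod_empty, tail_mk_zero, hg1 a]
  | succ m ih =>
    intro hm
    have hmK : m < K := hm
    have hsplit : (univ : Finset (Fin K)).filter (fun i : Fin K => i.val < m + 1)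
        = insert (⟨m, hmK⟩ : Fin K) ((univ : Finset (Fin K)).filter (fun i : Fin K => i.val < m)) := by
      ext i
      simp only [Finset.mem_filter, Finset.mem_univ, true_and, Finset.mem_insert, Fin.ext_iff]
      omega
    have hnot : (⟨m, hmK⟩ : Fin K) ∉ (univ : Finset (Fin K)).filter (fun i : Fin K => i.val < m) := by simp
    rw [hsplit, Finset.prod_insert hnot, ih (le_of_lt hmK)]
    have ec : (Fin.castSucc (⟨m, hmK⟩ : Fin K)) = (⟨m, Nat.lt_succ_of_le (le_of_lt hmK)⟩ : Fin (K + 1)) := rfl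
    have es : (Fin.succ (⟨m, hmK⟩ : Fin K)) = (⟨m + 1, Nat.lt_succ_of_le hm⟩ : Fin (K + 1)) := rfl
    rw [ec, es]
    by_cases h : tail (g a) ⟨m, Nat.lt_succ_of_le (le_of_lt hmK)⟩ = 0
    · rw [if_pos h, zero_mul]
      have hBA : tail (g a) ⟨m + 1, Nat.lt_succ_of_le hm⟩ ≤ tail (g a) ⟨m, Nat.lt_succ_of_le (le_of_lt hmK)⟩ :=
        tail_antitone (hg0 a) (Fin.mk_le_mk.2 (Nat.le_succ m))
      have hB0 : 0 ≤ tail (g a) ⟨m + 1, Nat.lt_succ_of_le hm⟩ := tail_nonneg (hg0 a) _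
      linarith
    · rw [if_neg h, div_mul_cancel₀ _ h]

variable (g : Fin d → Fin (K + 1) → ℝ)

/-- The encoding `σ(x) = {(a,i) : i < x_a}` is monotone. [this work] -/
theorem encode_mono {x y : Fin d → Fin (K + 1)} (h : x ≤ y) :
    (univ : Finset (Fin d × Fin K)).filter (fun p => p.2.castSucc < x p.1) ⊆ univ.filter (fun p => p.2.castSucc < y p.1) := by
  intro p hp
  simp only [Finset.mem_filter, Finset.mem_univ, true_and] at hp ⊢
  exact lt_of_lt_of_le hp (h p.1)

/-- The encoding turns joins into unions. [this work] -/
theorem encode_sup (x y : Fin d → Fin (K + 1)) :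
    (univ : Finset (Fin d × Fin K)).filter (fun p => p.2.castSucc < (x ⊔ y) p.1)
      = univ.filter (fun p => p.2.castSucc < x p.1) ∪ univ.filter (fun p => p.2.castSucc < y p.1) := by
  ext p
  simp only [Finset.mem_filter, Finset.mem_univ, true_and, Finset.mem_union, Pi.sup_apply, lt_sup_iff]

/-- The encoding turns finite joins into finite unions. [this work] -/
theorem encode_finset_sup {n : ℕ} (t : Fin n → Fin d → Fin (K + 1)) (S : Finset (Fin n)) :
    (univ : Finset (Fin d × Fin K)).filter (fun p => p.2.castSucc < (S.sup t) p.1)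
      = S.biUnion (fun l => univ.filter (fun p => p.2.castSucc < t l p.1)) := by
  induction S using Finset.induction_on with
  | empty => ext p; simp
  | insert a s ha ih => rw [Finset.sup_insert, encode_sup, ih, Finset.biUnion_insert]

/-- **The cylinder mass of the encoded orthant equals the orthant mass** `Π_a tail_a(x_a)`. [this work] -/
theorem cylMass_encode (hg0 : ∀ a u, 0 ≤ g a u) (hg1 : ∀ a, ∑ u, g a u = 1) (x : Fin d → Fin (K + 1)) :
    cylMass (fun p : Fin d × Fin K => if tail (g p.1) p.2.castSucc = 0 then (0 : ℝ) else tail (g p.1) p.2.succ / tail (g p.1) p.2.castSucc)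
      (univ.filter (fun p => p.2.castSucc < x p.1))
      = ∏ a, tail (g a) (x a) := by
  unfold cylMass
  rw [Finset.prod_filter, Fintype.prod_prod_type]
  refine Finset.prod_congr rfl fun a _ => ?_
  rw [← Finset.prod_filter]
  have hx : (x a).val ≤ K := Nat.le_of_lt_succ (x a).isLt
  have e : (univ : Finset (Fin K)).filter (fun i : Fin K => (Fin.castSucc i) < x a) = univ.filter (fun i : Fin K => i.val < (x a).val) := by
    ext i; simp [Fin.lt_def]
  rw [e, prod_bitBias_eq_tail g hg0 hg1 a (x a).val hx]

/-- **THE CONTRACTION INEQUALITY FOR ORTHANT PAIRS ON A GRID, EVERY ORDER, EVERY PRODUCT WEIGHT.**  Grid `Fin d → Fin (K+1)`, product probability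
weight `Π_a g_a(ω_a)`, `t_l ≤ b_l`, `s ∈ [0,1]`:  `s · E_n^{π}(1_{cyl t_l}) ≤ E_n^{B_s⊗π}(ε ? 1_{cyl t_l} : 1_{cyl b_l})`.  Transport of the cube theorem
`sahiE_coin_cylinders_ge` along the binary encoding of the chains. [this work] -/
theorem sahiE_coin_orthantPairs_grid_ge (hg0 : ∀ a u, 0 ≤ g a u) (hg1 : ∀ a, ∑ u, g a u = 1) {s : ℝ} (hs0 : 0 ≤ s) (hs1 : s ≤ 1)
    {n : ℕ} {t b : Fin n → Fin d → Fin (K + 1)} (htb : ∀ l, t l ≤ b l) :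
    s * sahiE (fun ω : Fin d → Fin (K + 1) => ∏ a, g a (ω a)) n (fun l => setInd (cyl (t l))) ≤
      sahiE (fun z : Bool × (Fin d → Fin (K + 1)) => if z.1 then s * ∏ a, g a (z.2 a) else (1 - s) * ∏ a, g a (z.2 a)) n
        (fun l (z : Bool × (Fin d → Fin (K + 1))) => if z.1 then setInd (cyl (t l)) z.2 else setInd (cyl (b l)) z.2) := by
  -- the encoded cube
  set q : Fin d × Fin K → unitInterval := fun p => ⟨_, bitBias_mem g hg0 p⟩ with hq
  set σt : Fin n → Finset (Fin d × Fin K) := fun l => univ.filter (fun p => p.2.castSucc < t l p.1) with hσt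
  set σb : Fin n → Finset (Fin d × Fin K) := fun l => univ.filter (fun p => p.2.castSucc < b l p.1) with hσb
  have hsub : ∀ l, σt l ⊆ σb l := fun l => encode_mono (htb l)
  have main := sahiE_coin_cylinders_ge q hs0 hs1 (n := n) hsub
  have eq_q : (fun p : Fin d × Fin K => ((q p : unitInterval) : ℝ)) = fun p =>
      if tail (g p.1) p.2.castSucc = 0 then (0 : ℝ) else tail (g p.1) p.2.succ / tail (g p.1) p.2.castSucc := rfl
  have emass : ∀ x : Fin d → Fin (K + 1), ex (fun ω : Fin d → Fin (K + 1) => ∏ a, g a (ω a)) (setInd (cyl x)) = ∏ a, tail (g a) (x a) := by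
    intro x; rw [ex_setInd, mass_cyl]
  -- (1) tops
  have e1 : sahiE (bernoulliWeight q) n (fun l (ω : Set (Fin d × Fin K)) => ind {ω : Set (Fin d × Fin K) | (σt l : Set (Fin d × Fin K)) ⊆ ω} ω)
      = sahiE (fun ω : Fin d → Fin (K + 1) => ∏ a, g a (ω a)) n (fun l => setInd (cyl (t l))) := by
    refine sahiE_congr_of_moments _ _ n _ _ fun S _ => ?_
    rw [prod_cylInd, prod_setInd_cyl, ex_ind_cyl', emass, eq_q, ← encode_finset_sup, cylMass_encode g hg0 hg1]
  -- (2) pairs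
  have e2 : sahiE (fun z : Bool × Set (Fin d × Fin K) => if z.1 then s * bernoulliWeight q z.2 else (1 - s) * bernoulliWeight q z.2) n
        (fun l (z : Bool × Set (Fin d × Fin K)) => if z.1 then ind {ω : Set (Fin d × Fin K) | (σt l : Set (Fin d × Fin K)) ⊆ ω} z.2
          else ind {ω : Set (Fin d × Fin K) | (σb l : Set (Fin d × Fin K)) ⊆ ω} z.2)
      = sahiE (fun z : Bool × (Fin d → Fin (K + 1)) => if z.1 then s * ∏ a, g a (z.2 a) else (1 - s) * ∏ a, g a (z.2 a)) n
        (fun l (z : Bool × (Fin d → Fin (K + 1))) => if z.1 then setInd (cyl (t l)) z.2 else setInd (cyl (b l)) z.2) := by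
    have f1 : (fun l (z : Bool × Set (Fin d × Fin K)) => if z.1 then ind {ω : Set (Fin d × Fin K) | (σt l : Set (Fin d × Fin K)) ⊆ ω} z.2
          else ind {ω : Set (Fin d × Fin K) | (σb l : Set (Fin d × Fin K)) ⊆ ω} z.2) = fun l => cSlot (σt l) (σb l) ((fun _ => (1 : ℝ)) l) := by
      funext l; exact cSlot_one_eq_pair (σt l) (σb l)
    rw [f1]
    refine sahiE_congr_of_moments _ _ n _ _ fun S _ => ?_
    rw [prod_cSlot, ex_cSlot, Finset.prod_const_one, prod_pairSlot_cyl, ex_coin_gen (fun ω : Fin d → Fin (K + 1) => ∏ a, g a (ω a)) s]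
    simp only [if_true, Bool.false_eq_true, if_false]
    rw [show (fun x => setInd (cyl (S.sup t)) x) = setInd (cyl (S.sup t)) from rfl,
      show (fun x => setInd (cyl (S.sup b)) x) = setInd (cyl (S.sup b)) from rfl,
      emass, emass, eq_q, ← encode_finset_sup, ← encode_finset_sup, cylMass_encode g hg0 hg1, cylMass_encode g hg0 hg1]
    ring
  rw [e1, e2] at main
  exact main

end

end Summit.CriticalPhenomena.PercolationContinuityZ3.Theorems.SahiTangentCyl
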